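import Mathlib
import HarnessLib
import Literature.MathematicalPhysics.QuantumLattice.LatticeScalarField

/-!
# Stub `stub_vertexBound` (crux `SelfNormalisedMomentBoundsR`, line `Sketch`)

Piece A2 of the discrete phase-cell assembly: the per-vertex sup bound
`√|f(a x)| · (a d(x, w))⁻⁴ ≤ 2^{4N+8}` for distinct sites `x ≠ w` of the box `{−L, …, L}⁴` read
with mesh `a ≤ 1 ≤ aL`, `a⁻¹ ≤ (aL)^N`, when `f` has unit Schwartz seminorms, `g (a w) ≠ 0` and
the supports of `f` and `g` are disjoint.  Here `d(x, w) = ‖v‖` is the torus distance in lattice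
units, `v μ` being the symmetric residue of `x μ − w μ` modulo the side `2L+1`.

Proof.  Either the torus separation is unwrapped in every coordinate (`v = x − w`): then
`a d = ‖a x − a w‖`, `a w ∉ tsupport f` (it lies in `tsupport g`), and the flatness of `f` at
`a w` gives `√|f(a x)| ≤ ‖a x − a w‖⁴`, so the product is at most `1`.  Or some coordinate `μ`
wraps: then `|v μ| ≥ L + 1 − |x μ| ≥ 1`, so `d ≥ 1`; if `‖a x‖ ≥ aL/2` the Schwartz decay
`|f(a x)| ≤ ‖a x‖^{−(8N+8)} ≤ (2/(aL))^{8N+8}` beats the kernel `(a d)⁻⁴ ≤ a⁻⁴ ≤ (aL)^{4N}`;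
if `‖a x‖ < aL/2` then `|x μ| < L/2`, hence `d > L/2`, `a d > 1/2`, and the kernel is below `16`
while `√|f| ≤ 1`.
-/

noncomputable section

open scoped SchwartzMap
open Literature.Probability.LatticeModels Literature.MathematicalPhysics.QuantumLattice

namespace Summit.QuantumFields.YangMills.Theorems.ScalingWindowSplit.SelfNormalisedMomentBoundsR

/-- Wrap-around estimate on the discrete torus of side `2L+1`: if the symmetric residue `v` of
`p − q` modulo `2L+1` differs from `p − q` and `|q| ≤ L`, then `|v| ≥ L + 1 − |p|`
(`v − (p − q)` is a non-zero multiple of `2L+1`). -/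
private theorem vertexBound_wrap (L : ℕ) (p q : ℤ) (hq : |q| ≤ L)
    (hne : ((p - q : ℤ) : ZMod (2 * L + 1)).valMinAbs ≠ p - q) :
    (L : ℤ) + 1 - |p| ≤ |((p - q : ℤ) : ZMod (2 * L + 1)).valMinAbs| := by
  set v : ℤ := ((p - q : ℤ) : ZMod (2 * L + 1)).valMinAbs with hv
  obtain ⟨c, hc⟩ : ((2 * L + 1 : ℕ) : ℤ) ∣ (p - q) - v :=
    (ZMod.intCast_eq_intCast_iff_dvd_sub v (p - q) (2 * L + 1)).mp (ZMod.coe_valMinAbs _)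
  push_cast at hc
  have hc0 : c ≠ 0 := by
    rintro rfl
    rw [mul_zero, sub_eq_zero] at hc
    exact hne hc.symm
  have h1 : (2 * L + 1 : ℤ) ≤ |p - q - v| := by
    rw [hc, abs_mul, abs_of_nonneg (by positivity : (0 : ℤ) ≤ 2 * L + 1)]
    exact le_mul_of_one_le_right (by positivity) (Int.one_le_abs hc0)
  have h2 : |p - q - v| ≤ |p| + |q| + |v| :=
    (abs_sub (p - q) v).trans (by gcongr; exact abs_sub p q)
  linarith

/-- The unwrapped regime: flatness of `f` at a point `z ∉ tsupport f` pays for the kernel,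
`√|f y| · ‖y − z‖⁻⁴ ≤ 1` when `‖f‖_{0,8} ≤ 1`. -/
private theorem vertexBound_flat
    (hflat : ∀ (M : ℕ) (f : 𝓢(EuclideanSpace ℝ (Fin 4), ℝ)) (y z : EuclideanSpace ℝ (Fin 4)),
      z ∉ tsupport (f : EuclideanSpace ℝ (Fin 4) → ℝ) →
      |f y| ≤ SchwartzMap.seminorm ℝ 0 M f * ‖y - z‖ ^ M)
    (f : 𝓢(EuclideanSpace ℝ (Fin 4), ℝ)) (y z : EuclideanSpace ℝ (Fin 4))
    (hz : z ∉ tsupport (f : EuclideanSpace ℝ (Fin 4) → ℝ))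
    (hs8 : SchwartzMap.seminorm ℝ 0 8 f ≤ 1) :
    Real.sqrt |f y| * (‖y - z‖⁻¹) ^ 4 ≤ 1 := by
  have hf : |f y| ≤ ‖y - z‖ ^ 8 :=
    (hflat 8 f y z hz).trans (mul_le_of_le_one_left (by positivity) hs8)
  have hsq : Real.sqrt |f y| ≤ ‖y - z‖ ^ 4 := by
    rw [Real.sqrt_le_left (by positivity), ← pow_mul]
    exact hf
  rcases eq_or_ne ‖y - z‖ 0 with hr | hr
  · rw [hr, inv_zero, zero_pow four_ne_zero, mul_zero]
    exact zero_le_one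
  · calc Real.sqrt |f y| * (‖y - z‖⁻¹) ^ 4 ≤ ‖y - z‖ ^ 4 * (‖y - z‖⁻¹) ^ 4 :=
          mul_le_mul_of_nonneg_right hsq (by positivity)
      _ = 1 := by rw [inv_pow, mul_inv_cancel₀ (pow_ne_zero 4 hr)]

/-- The far regime: the Schwartz decay `|f y| ≤ ‖y‖^{-(8N+8)} ≤ (2/b)^{8N+8}` beats the kernel
`(a d)⁻⁴ ≤ a⁻⁴ ≤ b^{4N}` (`b = aL ≥ 1`, `d ≥ 1`). -/
private theorem vertexBound_far (N : ℕ) (a b d : ℝ) (ha : 0 < a) (hb : 1 ≤ b)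
    (hvol : a⁻¹ ≤ b ^ N) (f : 𝓢(EuclideanSpace ℝ (Fin 4), ℝ)) (y : EuclideanSpace ℝ (Fin 4))
    (hsN : SchwartzMap.seminorm ℝ (8 * N + 8) 0 f ≤ 1) (hfar : b / 2 ≤ ‖y‖) (hd : 1 ≤ d) :
    Real.sqrt |f y| * ((a * d)⁻¹) ^ 4 ≤ 2 ^ (4 * N + 4) := by
  have hb0 : 0 < b := one_pos.trans_le hb
  have hbne : b ≠ 0 := hb0.ne'
  have hd0 : 0 < d := one_pos.trans_le hd
  have hy0 : 0 < ‖y‖ := (half_pos hb0).trans_le hfar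
  -- Schwartz decay of order `8N + 8`
  have hdec : ‖y‖ ^ (8 * N + 8) * |f y| ≤ 1 := by
    have h := SchwartzMap.norm_pow_mul_le_seminorm ℝ f (8 * N + 8) y
    rw [Real.norm_eq_abs] at h
    exact h.trans hsN
  have hinv : ‖y‖⁻¹ ≤ 2 / b := by
    have h := inv_anti₀ (half_pos hb0) hfar
    rwa [inv_div] at h
  have hfy : |f y| ≤ (2 / b) ^ (8 * N + 8) := by
    calc |f y| ≤ 1 / ‖y‖ ^ (8 * N + 8) := by
          rw [le_div_iff₀ (by positivity), mul_comm]
          exact hdec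
      _ = ‖y‖⁻¹ ^ (8 * N + 8) := by rw [one_div, inv_pow]
      _ ≤ (2 / b) ^ (8 * N + 8) := pow_le_pow_left₀ (by positivity) hinv _
  have hsq : Real.sqrt |f y| ≤ (2 / b) ^ (4 * N + 4) := by
    rw [Real.sqrt_le_left (by positivity), ← pow_mul]
    exact hfy.trans_eq (by ring)
  have hk : ((a * d)⁻¹) ^ 4 ≤ (b ^ N) ^ 4 := by
    apply pow_le_pow_left₀ (by positivity)
    calc (a * d)⁻¹ ≤ a⁻¹ := inv_anti₀ ha (le_mul_of_one_le_right ha.le hd)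
      _ ≤ b ^ N := hvol
  calc Real.sqrt |f y| * ((a * d)⁻¹) ^ 4 ≤ (2 / b) ^ (4 * N + 4) * (b ^ N) ^ 4 :=
        mul_le_mul hsq hk (by positivity) (by positivity)
    _ = (2 / b) ^ 4 * ((2 / b) * b) ^ (4 * N) := by ring
    _ = (2 / b) ^ 4 * 2 ^ (4 * N) := by rw [div_mul_cancel₀ _ hbne]
    _ ≤ 2 ^ 4 * 2 ^ (4 * N) := by
        gcongr
        exact div_le_self zero_le_two hb
    _ = 2 ^ (4 * N + 4) := by ring

/-- The inner wrapped regime: `√|f y| ≤ ‖f‖_{0,0} ≤ 1` and the kernel is at most `16` once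
`a d ≥ 1/2`. -/
private theorem vertexBound_inner (a d : ℝ) (f : 𝓢(EuclideanSpace ℝ (Fin 4), ℝ))
    (y : EuclideanSpace ℝ (Fin 4)) (hs0 : SchwartzMap.seminorm ℝ 0 0 f ≤ 1)
    (had : 1 / 2 ≤ a * d) : Real.sqrt |f y| * ((a * d)⁻¹) ^ 4 ≤ 2 ^ 4 := by
  have hfy : |f y| ≤ 1 := by
    have h := SchwartzMap.norm_le_seminorm ℝ f y
    rw [Real.norm_eq_abs] at h
    exact h.trans hs0
  have hsq : Real.sqrt |f y| ≤ 1 := Real.sqrt_le_one.mpr hfy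
  have had0 : 0 < a * d := by linarith
  have hk1 : (a * d)⁻¹ ≤ 2 := by
    calc (a * d)⁻¹ ≤ (1 / 2)⁻¹ := inv_anti₀ (by norm_num) had
      _ = 2 := by norm_num
  calc Real.sqrt |f y| * ((a * d)⁻¹) ^ 4 ≤ 1 * 2 ^ 4 :=
        mul_le_mul hsq (pow_le_pow_left₀ (inv_pos.mpr had0).le hk1 4)
          (pow_nonneg (inv_pos.mpr had0).le 4) zero_le_one
    _ = 2 ^ 4 := one_mul _

/-- **Registered stub `stub_vertexBound` (line `Sketch`; piece A2 of the assembly — the per-vertex sup bound).**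
On the box of half-side `L` read with mesh `a ≤ 1 ≤ aL`, `a⁻¹ ≤ (aL)^N`: if `f` and `g` have disjoint supports,
`g(a w) ≠ 0`, and `f` has unit Schwartz seminorms `‖f‖_{0,8}, ‖f‖_{0,0}, ‖f‖_{8N+8,0} ≤ 1`, then
`√|f(a x)| · (a d_torus(x, w))⁻⁴ ≤ 2^{4N+8}` for every other box site `x ≠ w`.  Three regimes: `x` far out
(`‖a x‖ ≥ aL/2`: Schwartz decay `(2/(aL))^{4N+4}` against the kernel `≤ a⁻⁴ ≤ (aL)^{4N}`); `x` inner and the torus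
separation unwrapped (flatness of `f` at `a w ∉ tsupport f`: `√|f(a x)| ≤ ‖a x − a w‖⁴`); `x` inner and wrapped
(then `d_torus > L/2`, kernel `< 16`). [folklore] -/
theorem stub_vertexBound :
    (∀ (M : ℕ) (f : 𝓢(EuclideanSpace ℝ (Fin 4), ℝ)) (y z : EuclideanSpace ℝ (Fin 4)),
      z ∉ tsupport (f : EuclideanSpace ℝ (Fin 4) → ℝ) →
      |f y| ≤ SchwartzMap.seminorm ℝ 0 M f * ‖y - z‖ ^ M) →
    ∀ (N L : ℕ) (a : ℝ), 0 < a → a ≤ 1 → 1 ≤ a * (L : ℝ) → a⁻¹ ≤ (a * (L : ℝ)) ^ N →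
    ∀ (f g : 𝓢(EuclideanSpace ℝ (Fin 4), ℝ)) (x w : Site 4), x ∈ box 4 L → w ∈ box 4 L → x ≠ w →
      Disjoint (tsupport (f : EuclideanSpace ℝ (Fin 4) → ℝ)) (tsupport (g : EuclideanSpace ℝ (Fin 4) → ℝ)) →
      g (a • siteToE w) ≠ 0 →
      SchwartzMap.seminorm ℝ 0 8 f ≤ 1 → SchwartzMap.seminorm ℝ 0 0 f ≤ 1 →
      SchwartzMap.seminorm ℝ (8 * N + 8) 0 f ≤ 1 →
      Real.sqrt |f (a • siteToE x)| *
          ((a * ‖siteToE (fun μ : Fin 4 => (((x μ - w μ : ℤ) : ZMod (2 * L + 1)).valMinAbs : ℤ))‖)⁻¹) ^ 4 ≤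
        2 ^ (4 * N + 8) := by
  intro hflat N L a ha0 _ha1 haL hvol f g x w hx hw _hxw hdisj hgw hs8 hs0 hsN
  -- name the torus separation vector `v`
  generalize hv : (fun μ : Fin 4 => (((x μ - w μ : ℤ) : ZMod (2 * L + 1)).valMinAbs : ℤ)) = v
  have hvμ : ∀ μ : Fin 4, v μ = (((x μ - w μ : ℤ) : ZMod (2 * L + 1)).valMinAbs : ℤ) :=
    fun μ => by rw [← hv]
  rcases em (∀ μ : Fin 4, v μ = x μ - w μ) with hA | hA
  · -- unwrapped: the torus separation is the Euclidean one, and `f` is flat at `a w`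
    have hvec : siteToE v = siteToE x - siteToE w := by
      ext μ
      simp only [siteToE_apply, PiLp.sub_apply]
      rw [hA μ, Int.cast_sub]
    have hz : a • siteToE w ∉ tsupport (f : EuclideanSpace ℝ (Fin 4) → ℝ) :=
      Set.disjoint_right.mp hdisj (subset_tsupport _ (Function.mem_support.mpr hgw))
    have hnorm : a * ‖siteToE x - siteToE w‖ = ‖a • siteToE x - a • siteToE w‖ := by
      rw [← smul_sub, norm_smul, Real.norm_of_nonneg ha0.le]
    rw [hvec, hnorm]
    exact (vertexBound_flat hflat f _ _ hz hs8).trans (one_le_pow₀ one_le_two)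
  · -- wrapped in some coordinate `i`: `|v i| ≥ L + 1 - |x i| ≥ 1`
    obtain ⟨i, hi⟩ := not_forall.mp hA
    have hxi : |x i| ≤ (L : ℤ) := abs_le.mpr (mem_box.mp hx i)
    have hwi : |w i| ≤ (L : ℤ) := abs_le.mpr (mem_box.mp hw i)
    have hwrap : (L : ℤ) + 1 - |x i| ≤ |v i| := by
      rw [hvμ i] at hi ⊢
      exact vertexBound_wrap L (x i) (w i) hwi hi
    set d : ℝ := ‖siteToE v‖ with hd
    have hcoord : |(v i : ℝ)| ≤ d := by
      have h := PiLp.norm_apply_le (siteToE v) i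
      rwa [Real.norm_eq_abs, siteToE_apply] at h
    have hwrapR : (L : ℝ) + 1 - |(x i : ℝ)| ≤ d := by
      have h := (Int.cast_le (R := ℝ)).mpr hwrap
      push_cast at h
      exact h.trans hcoord
    have hd1 : (1 : ℝ) ≤ d := by
      have h : (1 : ℤ) ≤ |v i| := by linarith
      have h' := (Int.cast_le (R := ℝ)).mpr h
      push_cast at h'
      exact h'.trans hcoord
    rcases le_or_gt (a * (L : ℝ) / 2) ‖a • siteToE x‖ with hfar | hin
    · -- far regime
      exact (vertexBound_far N a (a * L) d ha0 haL hvol f _ hsN hfar hd1).trans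
        (pow_le_pow_right₀ one_le_two (by omega))
    · -- inner wrapped regime
      have hxlt : |(x i : ℝ)| < L / 2 := by
        have h := PiLp.norm_apply_le (a • siteToE x) i
        rw [PiLp.smul_apply, siteToE_apply, smul_eq_mul, Real.norm_eq_abs, abs_mul,
          abs_of_pos ha0] at h
        have h2 : a * |(x i : ℝ)| < a * (L / 2) := by linarith
        exact lt_of_mul_lt_mul_left h2 ha0.le
      have had : 1 / 2 ≤ a * d := by
        have h1 : (L : ℝ) / 2 < d := by linarith
        have h2 : a * ((L : ℝ) / 2) < a * d := mul_lt_mul_of_pos_left h1 ha0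
        linarith
      exact (vertexBound_inner a d f _ hs0 had).trans (pow_le_pow_right₀ one_le_two (by omega))

end Summit.QuantumFields.YangMills.Theorems.ScalingWindowSplit.SelfNormalisedMomentBoundsR

end
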